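import Mathlib
import Summits.CriticalPhenomena.PercolationContinuityZ3.Theorems.PercNearOneGluingNoHeavyLowerTailTypedSectioningGeneral

/-!
# The complement-symmetric (Π2″) system: certificates modulo complementation (hp-7 gen 82)

Helper file for crux `stmt-CriticalPhenomena-4575` (`NoHeavyLowerTail`, route `PercNearOneGluingNoHeavy`), hull-port seat
`prim-hp-7` (generation 82); `--supports stmt-CriticalPhenomena-4575 --as helper`.  Pure finite set theory; everything is PROVED.
Memo: `run/shared/lean/prim/prim-hp-7/FROM-prim-hp-7-g82-GENERAL-ALLOCATION.md` §0 (G).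

The honest form of (Π2″) counts complementary PAIRS: `2 (#P + #Q + #W) ≤ #clU U (scTerms P Q W)` says that the `#P + #Q + #W`
complementary pairs `{s, U \ s}` of `𝒟 = cl(P ∪ Q ∪ W)` are at most the number of complementary pairs of the complement-closed family
`clU U (scTerms P Q W)`.  Fixing a base point `u₀ ∈ U` and representing every complementary pair by its member AVOIDING `u₀`
(`TypedSectioning.crep`), a pair system on the representatives whose terms are representatives of members of `clU U X` proves
`2 · #𝓣 ≤ #clU U X` as soon as it is certified (`two_mul_card_le_card_clU_of_pcert_crep`) — with NO complement-freeness hypothesis on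
the terms (the defect of the transversal systems of `…TypedSectioningGeneral`, hypothesis `hcc` there).  In this form a minuend pair
`{s, U \ s}` may use the close differences of BOTH members, i.e. for the blocks of a depth-one configuration (`symTerms`):
`p: p \ t, t \ p (t ∈ P ∪ Q ∪ W)`, `q: q \ t, t \ q (t ∈ P ∪ Q), q ∩ w, q ∪ w`, `w: w \ p, p \ w, w ∩ q, w ∪ q` — differences in both
directions, meets AND joins (`symTerms_subset_scTerms`).  The bridges `two_mul_card_le_card_clU_scTerms_of_pcert_sym` ((Π2″)) and
`card_le_card_farNbhd_of_pcert_sym` (Hall for the dead set of a depth-one antipodal instance) follow.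

Census (memo §0 (G)): with the canonical Ahlswede–Daykin children (projected child = everything, doubled child = all doubled classes,
NO allocation freedom) the symmetric system is certified on exhaustive `2^[5]` (31 160 derived instances), zoo 112, residue 1 200, the
`#F = 8` hybrid-only type 360, annealer states `n ≤ 10`; in this system 'certifiable ⟺ count' held at every node visited.
-/

namespace Summit.CriticalPhenomena.PercolationContinuityZ3.Theorems

namespace TypedSectioning

open Finset GeneratedDonors
open scoped FinsetFamily

variable {α : Type*} [DecidableEq α]

/-- The representative of the complementary pair `{s, U \ s}` avoiding the base point `u₀`. -/
def crep (U : Finset α) (u₀ : α) (s : Finset α) : Finset α := if u₀ ∈ s then U \ s else s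

/-- The representative avoids the base point (for `s ⊆ U`). -/
theorem base_notMem_crep (U : Finset α) (u₀ : α) (s : Finset α) : u₀ ∉ crep U u₀ s := by
  unfold crep
  split_ifs with h
  · exact fun h' => (mem_sdiff.mp h').2 h
  · exact h

/-- The representative of a member of a `U`-complement-closed family stays in the family. -/
theorem crep_mem_clU {U : Finset α} (u₀ : α) {X : Finset (Finset α)} {t : Finset α} (ht : t ∈ X) :
    crep U u₀ t ∈ clU U X := by
  unfold crep
  split_ifs
  · exact mem_clU.mpr (Or.inr ⟨t, ht, rfl⟩)
  · exact mem_clU.mpr (Or.inl ht)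

/-- `crep` is injective on a complement-free family of subsets of `U`. -/
theorem crep_injOn {U : Finset α} {u₀ : α} {𝓣 : Finset (Finset α)} (hU : ∀ s ∈ 𝓣, s ⊆ U)
    (hcf : ∀ a ∈ 𝓣, ∀ b ∈ 𝓣, a ≠ U \ b) : Set.InjOn (crep U u₀) ↑𝓣 := by
  intro a ha b hb h
  have ha' : a ∈ 𝓣 := mem_coe.mp ha
  have hb' : b ∈ 𝓣 := mem_coe.mp hb
  have hcc : ∀ {s : Finset α}, s ⊆ U → U \ (U \ s) = s := fun hs => Finset.sdiff_sdiff_eq_self hs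
  unfold crep at h
  by_cases h1 : u₀ ∈ a <;> by_cases h2 : u₀ ∈ b <;> simp only [h1, h2, if_true, if_false] at h
  · have := congrArg (fun s => U \ s) h
    simp only [hcc (hU a ha'), hcc (hU b hb')] at this
    exact this
  · exact absurd h.symm (hcf b hb' a ha')
  · exact absurd h (hcf a ha' b hb')
  · exact h

/-- In a `U`-complement-closed family of subsets of `U`, at most half of the members avoid a point `u₀ ∈ U`:
`2 · #{t ∈ clU U X : u₀ ∉ t} ≤ #clU U X`. -/
theorem two_mul_card_filter_notMem_le_card_clU {U : Finset α} {u₀ : α} (hu₀ : u₀ ∈ U) {X : Finset (Finset α)}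
    (hX : ∀ t ∈ X, t ⊆ U) :
    2 * #((clU U X).filter fun t => u₀ ∉ t) ≤ #(clU U X) := by
  classical
  have hcc : ∀ {s : Finset α}, s ⊆ U → U \ (U \ s) = s := fun hs => Finset.sdiff_sdiff_eq_self hs
  have hXU : ∀ t ∈ clU U X, t ⊆ U := by
    intro t ht
    rcases mem_clU.mp ht with h | ⟨u, -, rfl⟩
    · exact hX t h
    · exact sdiff_subset
  have hco : ∀ t ∈ clU U X, U \ t ∈ clU U X := by
    intro t ht
    rcases mem_clU.mp ht with h | ⟨u, hu, rfl⟩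
    · exact mem_clU.mpr (Or.inr ⟨t, h, rfl⟩)
    · rw [hcc (hX u hu)]; exact mem_clU.mpr (Or.inl hu)
  set A := (clU U X).filter fun t => u₀ ∉ t with hA
  set B := (clU U X).filter fun t => u₀ ∈ t with hB
  have himg : A.image (fun t => U \ t) ⊆ B := by
    intro s hs
    obtain ⟨t, ht, rfl⟩ := mem_image.mp hs
    obtain ⟨ht1, ht2⟩ := mem_filter.mp ht
    exact mem_filter.mpr ⟨hco t ht1, mem_sdiff.mpr ⟨hu₀, ht2⟩⟩
  have hinj : Set.InjOn (fun t : Finset α => U \ t) ↑A := by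
    intro t ht t' ht' h
    have h' := congrArg (fun s => U \ s) h
    simp only [hcc (hXU t (mem_filter.mp (mem_coe.mp ht)).1), hcc (hXU t' (mem_filter.mp (mem_coe.mp ht')).1)] at h'
    exact h'
  have hAB : #A ≤ #B := by
    rw [← card_image_of_injOn hinj]; exact card_le_card himg
  have hsplit : #B + #A = #(clU U X) := by
    rw [hB, hA]; exact card_filter_add_card_filter_not (s := clU U X) (fun t => u₀ ∈ t)
  omega

/-- **Counting modulo complementation** (hp-7 gen 82).  Let `𝓣` be a complement-free family of subsets of `U` and `u₀ ∈ U`.  If the pair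
system on the representatives `crep U u₀ s` (`s ∈ 𝓣`) is certified with terms among the representatives avoiding `u₀` of a family `clU U X`
(`X ⊆ 𝒫 U`), then `2 · #𝓣 ≤ #clU U X`.  No complement-freeness of the terms is needed. -/
theorem two_mul_card_le_card_clU_of_pcert_crep {U : Finset α} {u₀ : α} (hu₀ : u₀ ∈ U) (𝓣 X : Finset (Finset α))
    (hU : ∀ s ∈ 𝓣, s ⊆ U) (hcf : ∀ a ∈ 𝓣, ∀ b ∈ 𝓣, a ≠ U \ b) (hX : ∀ t ∈ X, t ⊆ U)
    (A : Finset α → Finset (Finset α)) (hcert : PCert (𝓣.image (crep U u₀)) A)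
    (hT : pterms (𝓣.image (crep U u₀)) A ⊆ (clU U X).filter fun t => u₀ ∉ t) :
    2 * #𝓣 ≤ #(clU U X) := by
  have h1 : #𝓣 = #(𝓣.image (crep U u₀)) := (card_image_of_injOn (crep_injOn hU hcf)).symm
  have h2 : #(𝓣.image (crep U u₀)) ≤ #((clU U X).filter fun t => u₀ ∉ t) := card_le_card_of_pcert hcert hT
  have h3 := two_mul_card_filter_notMem_le_card_clU hu₀ hX
  omega

/-! ### The symmetric menus of a depth-one configuration -/

/-- The close differences of BOTH members of the complementary pair of a minuend `s` of the configuration `(P, Q, W)` (labels `i`,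
`i+1`, `i+5`; alive–alive pairs removed): `p: p \ t, t \ p (t ∈ P ∪ Q ∪ W)`; `q: q \ t, t \ q (t ∈ P ∪ Q), q ∩ w, q ∪ w (w ∈ W)`;
`w: w \ p, p \ w (p ∈ P), w ∩ q, w ∪ q (q ∈ Q)`. -/
def symTerms (P Q W : Finset (Finset α)) (s : Finset α) : Finset (Finset α) :=
  (if s ∈ P then (P ∪ Q ∪ W).image (fun t => s \ t) ∪ (P ∪ Q ∪ W).image (fun t => t \ s) else ∅) ∪
  ((if s ∈ Q then ((P ∪ Q).image (fun t => s \ t) ∪ (P ∪ Q).image (fun t => t \ s)) ∪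
      (W.image (fun t => s ∩ t) ∪ W.image (fun t => s ∪ t)) else ∅) ∪
   (if s ∈ W then (P.image (fun t => s \ t) ∪ P.image (fun t => t \ s)) ∪
      (Q.image (fun t => s ∩ t) ∪ Q.image (fun t => s ∪ t)) else ∅))

/-- Every symmetric term of a minuend lies in the (Π2″) term family `scTerms P Q W`. -/
theorem symTerms_subset_scTerms (P Q W : Finset (Finset α)) (s : Finset α) : symTerms P Q W s ⊆ scTerms P Q W := by
  intro E hE
  unfold scTerms
  simp only [mem_union]
  unfold symTerms at hE
  simp only [mem_union] at hE
  rcases hE with h | h | h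
  · split_ifs at h with hs
    · simp only [mem_union] at h
      rcases h with h | h
      · obtain ⟨t, ht, rfl⟩ := mem_image.mp h
        simp only [mem_union] at ht
        rcases ht with (ht | ht) | ht
        · exact Or.inl (Or.inl (Or.inl (Or.inl (Or.inl (Or.inl (Or.inl (mem_diffs.mpr ⟨s, hs, t, ht, rfl⟩)))))))
        · exact Or.inl (Or.inl (Or.inl (Or.inl (Or.inl (Or.inr (mem_diffs.mpr ⟨s, hs, t, ht, rfl⟩))))))
        · exact Or.inl (Or.inl (Or.inl (Or.inr (mem_diffs.mpr ⟨s, hs, t, ht, rfl⟩))))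
      · obtain ⟨t, ht, rfl⟩ := mem_image.mp h
        simp only [mem_union] at ht
        rcases ht with (ht | ht) | ht
        · exact Or.inl (Or.inl (Or.inl (Or.inl (Or.inl (Or.inl (Or.inl (mem_diffs.mpr ⟨t, ht, s, hs, rfl⟩)))))))
        · exact Or.inl (Or.inl (Or.inl (Or.inl (Or.inr (mem_diffs.mpr ⟨t, ht, s, hs, rfl⟩)))))
        · exact Or.inl (Or.inl (Or.inr (mem_diffs.mpr ⟨t, ht, s, hs, rfl⟩)))
    · simp at h
  · split_ifs at h with hs
    · simp only [mem_union] at h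
      rcases h with (h | h) | (h | h)
      · obtain ⟨t, ht, rfl⟩ := mem_image.mp h
        rcases mem_union.mp ht with ht | ht
        · exact Or.inl (Or.inl (Or.inl (Or.inl (Or.inr (mem_diffs.mpr ⟨s, hs, t, ht, rfl⟩)))))
        · exact Or.inl (Or.inl (Or.inl (Or.inl (Or.inl (Or.inl (Or.inr (mem_diffs.mpr ⟨s, hs, t, ht, rfl⟩)))))))
      · obtain ⟨t, ht, rfl⟩ := mem_image.mp h
        rcases mem_union.mp ht with ht | ht
        · exact Or.inl (Or.inl (Or.inl (Or.inl (Or.inl (Or.inr (mem_diffs.mpr ⟨t, ht, s, hs, rfl⟩))))))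
        · exact Or.inl (Or.inl (Or.inl (Or.inl (Or.inl (Or.inl (Or.inr (mem_diffs.mpr ⟨t, ht, s, hs, rfl⟩)))))))
      · obtain ⟨t, ht, rfl⟩ := mem_image.mp h
        exact Or.inl (Or.inr (mem_infs.mpr ⟨s, hs, t, ht, rfl⟩))
      · obtain ⟨t, ht, rfl⟩ := mem_image.mp h
        exact Or.inr (mem_sups.mpr ⟨s, hs, t, ht, rfl⟩)
    · simp at h
  · split_ifs at h with hs
    · simp only [mem_union] at h
      rcases h with (h | h) | (h | h)
      · obtain ⟨t, ht, rfl⟩ := mem_image.mp h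
        exact Or.inl (Or.inl (Or.inr (mem_diffs.mpr ⟨s, hs, t, ht, rfl⟩)))
      · obtain ⟨t, ht, rfl⟩ := mem_image.mp h
        exact Or.inl (Or.inl (Or.inl (Or.inr (mem_diffs.mpr ⟨t, ht, s, hs, rfl⟩))))
      · obtain ⟨t, ht, rfl⟩ := mem_image.mp h
        exact Or.inl (Or.inr (mem_infs.mpr ⟨t, ht, s, hs, inter_comm t s⟩))
      · obtain ⟨t, ht, rfl⟩ := mem_image.mp h
        exact Or.inr (mem_sups.mpr ⟨t, ht, s, hs, union_comm t s⟩)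
    · simp at h

/-- The symmetric allowed-term function on representatives: the representative `R` of the pair of `s ∈ P ∪ Q ∪ W` may use the
representatives of all symmetric terms of `s`. -/
def symA (U : Finset α) (u₀ : α) (P Q W : Finset (Finset α)) : Finset α → Finset (Finset α) := fun R =>
  ((P ∪ Q ∪ W).filter fun s => crep U u₀ s = R).biUnion fun s => (symTerms P Q W s).image (crep U u₀)

/-- The terms of the symmetric system are representatives (avoiding `u₀`) of members of `clU U (scTerms P Q W)`. -/
theorem pterms_symA_subset (U : Finset α) (u₀ : α) (P Q W : Finset (Finset α)) :
    pterms ((P ∪ Q ∪ W).image (crep U u₀)) (symA U u₀ P Q W) ⊆ (clU U (scTerms P Q W)).filter fun t => u₀ ∉ t := by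
  intro E hE
  obtain ⟨R, -, hER⟩ := mem_pterms.mp hE
  unfold symA at hER
  simp only [mem_biUnion, mem_filter, mem_image] at hER
  obtain ⟨s, ⟨-, -⟩, t, ht, rfl⟩ := hER
  exact mem_filter.mpr ⟨crep_mem_clU u₀ (symTerms_subset_scTerms P Q W s ht), base_notMem_crep U u₀ t⟩

variable {U : Finset α}

/-- **(Π2″) from a certificate of the symmetric system** (hp-7 gen 82): pairwise disjoint `P, Q, W ⊆ 𝒫 U` with `P ∪ Q ∪ W` complement-free,
a base point `u₀ ∈ U`, and a certificate of the symmetric pair system on the representatives give `2 (#P + #Q + #W) ≤ #clU U (scTerms P Q W)` —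
without any hypothesis on coincidences among the terms. -/
theorem two_mul_card_le_card_clU_scTerms_of_pcert_sym (P Q W : Finset (Finset α)) {u₀ : α} (hu₀ : u₀ ∈ U)
    (hU : ∀ a ∈ P ∪ Q ∪ W, a ⊆ U) (hPQ : Disjoint P Q) (hFW : Disjoint (P ∪ Q) W)
    (hcf : ∀ a ∈ P ∪ Q ∪ W, ∀ b ∈ P ∪ Q ∪ W, a ≠ U \ b)
    (hcert : PCert ((P ∪ Q ∪ W).image (crep U u₀)) (symA U u₀ P Q W)) :
    2 * (#P + #Q + #W) ≤ #(clU U (scTerms P Q W)) := by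
  have hcard : #(P ∪ Q ∪ W) = #P + #Q + #W := by
    rw [card_union_of_disjoint hFW, card_union_of_disjoint hPQ]
  have hX : ∀ t ∈ scTerms P Q W, t ⊆ U := by
    intro t ht
    unfold scTerms at ht
    simp only [mem_union] at ht
    have hPU : ∀ a ∈ P, a ⊆ U := fun a ha => hU a (by simp [ha])
    have hQU : ∀ a ∈ Q, a ⊆ U := fun a ha => hU a (by simp [ha])
    have hWU : ∀ a ∈ W, a ⊆ U := fun a ha => hU a (by simp [ha])
    rcases ht with ((((((h | h) | h) | h) | h) | h) | h) | h
    · obtain ⟨a, ha, b, -, rfl⟩ := mem_diffs.mp h; exact sdiff_subset.trans (hPU a ha)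
    · obtain ⟨a, ha, b, -, rfl⟩ := mem_diffs.mp h; exact sdiff_subset.trans (hQU a ha)
    · obtain ⟨a, ha, b, -, rfl⟩ := mem_diffs.mp h; exact sdiff_subset.trans (hPU a ha)
    · obtain ⟨a, ha, b, -, rfl⟩ := mem_diffs.mp h; exact sdiff_subset.trans (hQU a ha)
    · obtain ⟨a, ha, b, -, rfl⟩ := mem_diffs.mp h; exact sdiff_subset.trans (hPU a ha)
    · obtain ⟨a, ha, b, -, rfl⟩ := mem_diffs.mp h; exact sdiff_subset.trans (hWU a ha)
    · obtain ⟨a, ha, b, -, rfl⟩ := mem_infs.mp h; exact inf_le_left.trans (hQU a ha)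
    · obtain ⟨a, ha, b, hb, rfl⟩ := mem_sups.mp h; exact sup_le (hQU a ha) (hWU b hb)
  rw [← hcard]
  exact two_mul_card_le_card_clU_of_pcert_crep hu₀ (P ∪ Q ∪ W) (scTerms P Q W) hU hcf hX (symA U u₀ P Q W) hcert
    (pterms_symA_subset U u₀ P Q W)

section DepthOne

variable {𝒟 : Finset (Finset α)} {x : Finset α → ZMod 6}

/-- **(MATCH*) from a certificate of the symmetric system** (hp-7 gen 82): for an antipodal instance with dead labels in `{i, i+1, i+3, i+4}`
and alive labels in `{i+5, i+2}` (depth one), let `P`, `Q` be the dead classes of labels `i`, `i+1` and `W` the alive class of label `i+5`.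
A certificate of the symmetric pair system (any base point `u₀ ∈ U`) gives Hall's condition for the dead set:
`#𝒟 ≤ #(farNbhd 𝒟 x (dead U 𝒟 x))`. -/
theorem card_le_card_farNbhd_of_pcert_sym (hU : ∀ a ∈ 𝒟, a ⊆ U) (hco : ∀ a ∈ 𝒟, U \ a ∈ 𝒟)
    (hanti : ∀ a ∈ 𝒟, x (U \ a) = x a + 3) (i : ZMod 6)
    (hlab : ∀ a ∈ dead U 𝒟 x, x a = i ∨ x a = i + 1 ∨ x a = i + 3 ∨ x a = i + 4)
    (halive : ∀ d ∈ 𝒟, d ∉ dead U 𝒟 x → x d = i + 5 ∨ x d = i + 2)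
    (P Q W : Finset (Finset α)) (hPdef : P = (dead U 𝒟 x).filter fun a => x a = i)
    (hQdef : Q = (dead U 𝒟 x).filter fun a => x a = i + 1) (hWdef : W = (𝒟 \ dead U 𝒟 x).filter fun a => x a = i + 5)
    {u₀ : α} (hu₀ : u₀ ∈ U) (hcert : PCert ((P ∪ Q ∪ W).image (crep U u₀)) (symA U u₀ P Q W)) :
    #𝒟 ≤ #(farNbhd 𝒟 x (dead U 𝒟 x)) := by
  classical
  obtain ⟨n01, n30, n31, n40, n41, n85, n50, n51, n20, n21, n25, n53, n54, e33, e43, e23⟩ := label_facts i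
  have hP : ∀ p ∈ P, p ∈ dead U 𝒟 x ∧ x p = i := fun p hp => by
    rw [hPdef] at hp; have h := mem_filter.mp hp; exact ⟨h.1, h.2⟩
  have hQ : ∀ q ∈ Q, q ∈ dead U 𝒟 x ∧ x q = i + 1 := fun q hq => by
    rw [hQdef] at hq; have h := mem_filter.mp hq; exact ⟨h.1, h.2⟩
  have hW : ∀ w ∈ W, (w ∈ 𝒟 ∧ w ∉ dead U 𝒟 x) ∧ x w = i + 5 := fun w hw => by
    rw [hWdef] at hw; have h := mem_filter.mp hw; exact ⟨mem_sdiff.mp h.1, h.2⟩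
  have hdD : ∀ {a}, a ∈ dead U 𝒟 x → a ∈ 𝒟 := fun ha => (mem_filter.mp ha).1
  have hcc' : ∀ {a}, a ⊆ U → U \ (U \ a) = a := fun ha => Finset.sdiff_sdiff_eq_self ha
  have hmemD : ∀ a ∈ P ∪ Q ∪ W, a ∈ 𝒟 := by
    intro a ha
    simp only [mem_union] at ha
    rcases ha with (ha | ha) | ha
    · exact hdD (hP a ha).1
    · exact hdD (hQ a ha).1
    · exact (hW a ha).1.1
  have h1 : ∀ a ∈ P ∪ Q ∪ W, a ⊆ U := fun a ha => hU a (hmemD a ha)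
  have h2 : Disjoint P Q := by
    rw [Finset.disjoint_left]
    intro a haP haQ
    exact n01 ((hP a haP).2.symm.trans (hQ a haQ).2)
  have h3 : Disjoint (P ∪ Q) W := by
    rw [Finset.disjoint_left]
    intro a haF haW
    rcases mem_union.mp haF with ha | ha
    · exact (hW a haW).1.2 (hP a ha).1
    · exact (hW a haW).1.2 (hQ a ha).1
  -- labels of members of P ∪ Q ∪ W lie in {i, i+1, i+5}; the label of a complement is shifted by 3, so no member is a complement of another
  have hlab3 : ∀ a ∈ P ∪ Q ∪ W, x a = i ∨ x a = i + 1 ∨ x a = i + 5 := by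
    intro a ha
    simp only [mem_union] at ha
    rcases ha with (ha | ha) | ha
    · exact Or.inl (hP a ha).2
    · exact Or.inr (Or.inl (hQ a ha).2)
    · exact Or.inr (Or.inr (hW a ha).2)
  have hcf : ∀ a ∈ P ∪ Q ∪ W, ∀ b ∈ P ∪ Q ∪ W, a ≠ U \ b := by
    intro a ha b hb hab
    have hxa : x a = x b + 3 := by rw [hab]; exact hanti b (hmemD b hb)
    have key : ∀ j : ZMod 6, ∀ s t : ZMod 6, (s = j ∨ s = j + 1 ∨ s = j + 5) → (t = j ∨ t = j + 1 ∨ t = j + 5) → s ≠ t + 3 := by decide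
    exact key i (x a) (x b) (hlab3 a ha) (hlab3 b hb) hxa
  have hineq : 2 * (#P + #Q + #W) ≤ #(clU U (scTerms P Q W)) :=
    two_mul_card_le_card_clU_scTerms_of_pcert_sym P Q W hu₀ h1 h2 h3 hcf hcert
  have hsub : clU U (scTerms P Q W) ⊆ farNbhd 𝒟 x (dead U 𝒟 x) :=
    clU_scTerms_subset_farNbhd hU hco hanti i hP hQ (fun w hw => ⟨(hW w hw).1.1, (hW w hw).2⟩)
  -- counting 𝒟: every member or its complement lies in P ∪ Q ∪ W
  set A : Finset (Finset α) := 𝒟.filter fun d => x d = i ∨ x d = i + 1 ∨ x d = i + 5 with hAdef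
  set B : Finset (Finset α) := 𝒟.filter fun d => ¬ (x d = i ∨ x d = i + 1 ∨ x d = i + 5) with hBdef
  have hmemPQW : ∀ d ∈ 𝒟, (x d = i ∨ x d = i + 1 ∨ x d = i + 5) → d ∈ P ∪ Q ∪ W := by
    intro d hd hx
    simp only [mem_union]
    by_cases hdead : d ∈ dead U 𝒟 x
    · rcases hx with h | h | h
      · left; left; rw [hPdef]; exact mem_filter.mpr ⟨hdead, h⟩
      · left; right; rw [hQdef]; exact mem_filter.mpr ⟨hdead, h⟩
      · exfalso
        rcases hlab d hdead with h' | h' | h' | h'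
        · exact n50 (h.symm.trans h')
        · exact n51 (h.symm.trans h')
        · exact n53 (h.symm.trans h')
        · exact n54 (h.symm.trans h')
    · rcases halive d hd hdead with h5' | h2'
      · right; rw [hWdef]; exact mem_filter.mpr ⟨mem_sdiff.mpr ⟨hd, hdead⟩, h5'⟩
      · exfalso
        rcases hx with h | h | h
        · exact n20 (h2'.symm.trans h)
        · exact n21 (h2'.symm.trans h)
        · exact n25 (h2'.symm.trans h)
  have hA : A ⊆ P ∪ Q ∪ W := fun d hd => hmemPQW d (mem_filter.mp hd).1 (mem_filter.mp hd).2
  have hB : B.image (fun d => U \ d) ⊆ P ∪ Q ∪ W := by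
    intro e he
    obtain ⟨d, hd, rfl⟩ := mem_image.mp he
    obtain ⟨hdD', hnot⟩ := mem_filter.mp hd
    refine hmemPQW (U \ d) (hco d hdD') ?_
    rw [hanti d hdD']
    by_cases hdead : d ∈ dead U 𝒟 x
    · rcases hlab d hdead with h | h | h | h
      · exact absurd (Or.inl h) hnot
      · exact absurd (Or.inr (Or.inl h)) hnot
      · rw [h]; exact Or.inl e33
      · rw [h]; exact Or.inr (Or.inl e43)
    · rcases halive d hdD' hdead with h5' | h2'
      · exact absurd (Or.inr (Or.inr h5')) hnot
      · rw [h2']; exact Or.inr (Or.inr e23)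
  have hinjB : Set.InjOn (fun d : Finset α => U \ d) ↑B := by
    intro d hd e he hde
    have hdU : d ⊆ U := hU d (mem_filter.mp (mem_coe.mp hd)).1
    have heU : e ⊆ U := hU e (mem_filter.mp (mem_coe.mp he)).1
    have h1' := congrArg (fun t => U \ t) hde
    simp only [hcc' hdU, hcc' heU] at h1'
    exact h1'
  have hsplit : #A + #B = #𝒟 := card_filter_add_card_filter_not _
  have hcardA : #A ≤ #(P ∪ Q ∪ W) := card_le_card hA
  have hcardB : #B ≤ #(P ∪ Q ∪ W) := by
    rw [← card_image_of_injOn hinjB]; exact card_le_card hB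
  have hunion : #(P ∪ Q ∪ W) ≤ #P + #Q + #W :=
    (card_union_le _ _).trans (Nat.add_le_add_right (card_union_le _ _) _)
  have hT := card_le_card hsub
  omega

end DepthOne

end TypedSectioning

end Summit.CriticalPhenomena.PercolationContinuityZ3.Theorems
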